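import Summits.QuantumFields.YangMills.Theorems.LuscherReductionTwistedTraceScalingBOAssembly
import Summits.QuantumFields.YangMills.Theorems.LuscherReductionTwistedTraceScalingBOAssemblySlow
import HarnessLib

/-!
# THE SHELL ASSEMBLY, part 1 (fixed `β`): the SUP-version Born–Oppenheimer split of a thin C4-SHELL — slow clause with the ONE-SITE ANNULUS GAIN, stiff domination, off-diagonal
# (lane A of S-BASE, crux `TwistedTraceScaling` stmt-QuantumFields-20203, line «twolattice», stub `stub_fixedLatticeTraceLaw`; lead g23; card `pub/ym-fleet/ym-luscher-20007-p1/Lines-shell-gain.md` §3)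

The shell twin of ✓`slow_clause_of_bricks` / ✓`softTubeBOPackageOn_of_bricks` (`…BOAssemblySlow`, `…BOAssembly`) at ONE `β` (all data numbers/functions): NO min–max (a sup bound for ONE
function `f`), the one-site spectral input is an ANNULUS GAIN `q₁(G) ≤ (1 − g)μ₀‖G‖²` for gauge-invariant amplitudes supported in `{6t ≤ orbitDist₁ < 2}` (a HYPOTHESIS here; part 2 feeds
✓`oneSite_annulus_gain_orbitDist`), and the rates `κ` ((B-T)/(B-N)) and `b` ((B-OD)) are NOT assumed small against `λ_b` — they appear in the final gain `min(g − 6κ − 2b²/θ₀, θ₀/2)`.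
* §1 `arith_shell` — `Σ(1−g+6κ)N_u + 2bΣ√N_u√N_v + (1−θ)ΣN_v ≤ Σ·(1 − min(g − 6κ − 2b²/θ, θ/2))·(N_u + N_v)`; `arith_slow_shell`;
* §2 ★★ `shell_slow_clause` — `T(Pf) ≤ σμ₀(1 − g + 6κ)‖Pf‖²_w` (`P = boProj w Ω 𝒰`): colour average (✓`tubeForm_colourAvg`, ✓`colourAvg_boFun`), kernel brick (B-T, upper) on the slow window,
  the annulus gain for the colour-averaged amplitude (it is supported in `{6t ≤ orbitDist₁}` by the inner support of `boCoeff f`, and in `{orbitDist₁ < δ₁ ≤ 2}`), fibre mass (B-N);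
* §3 ★★ `shell_gain_fixed` — with (B-ST) on `v = f − Pf` (fibrewise `Ω`-orthogonal, ✓`remainder_props`) and (B-OD): `T(f) ≤ σμ₀·(1 − min(g − 6κ − 2b²/θ₀, θ₀/2))·‖f‖²_w`
  (MASS exact ✓`tubeNormSq_boProj_add`, ✓`tubeForm_add`).
Part 2 (`…ShellAssembly`): the brick list `ShellBricks` and the eventual assembly `ShellBricks L χ δc δ → ShellGainOneOrbitAt L δc δ η`.
HONEST FRAMING: assembly algebra (PROVED) for a stub of a child of the CONDITIONAL reduction route R2b1; the analytic bricks of a thin shell at slow radius `β^{−b}`, `b ≤ 1/6`, are OPEN;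
C4-SHELL, COARSE-UPPER/LOWER/TAIL, the stubs and the crux stay OPEN; not infinite volume, not a mass gap, not Clay.  No definitions, no `sorry`.
-/

set_option autoImplicit false

noncomputable section

open MeasureTheory Filter Topology Real
open scoped BigOperators
open Literature.MathematicalPhysics.QuantumFieldTheory
open Literature.MathematicalPhysics.QuantumLattice

namespace Summit.QuantumFields.YangMills.Theorems.FemtoTransferGap.TwoLattice.ConstTube

open Summit.QuantumFields.YangMills.Theorems.FemtoTransferGap
open Summit.QuantumFields.YangMills.Theorems.FemtoTransferGap.TwoLattice.Avg
open Summit.QuantumFields.YangMills.Theorems.FemtoTransferGap.TwoLattice.Stiff (LinkSpace)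

variable {L : ℕ} [NeZero L]

/-! ## §1 The arithmetic of the sup-version Feshbach endgame -/

/-- ★ **Shell endgame arithmetic**: `T_u ≤ Σ(1−g+6κ)N_u`, `X ≤ 2bΣ√N_u√N_v`, `T_v ≤ (1−θ)ΣN_v` ⇒ `T_u + X + T_v ≤ Σ(1 − min(g − 6κ − 2b²/θ, θ/2))(N_u + N_v)`
(`2b√N_u√N_v ≤ (2b²/θ)N_u + (θ/2)N_v`). [folklore] -/
theorem arith_shell {S Nu Nv g κ b θ Tu X Tv : ℝ} (hS : 0 ≤ S) (hNu : 0 ≤ Nu) (hNv : 0 ≤ Nv) (hθ : 0 < θ)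
    (hTu : Tu ≤ S * (1 - g + 6 * κ) * Nu) (hX : X ≤ 2 * (b * S) * Real.sqrt Nu * Real.sqrt Nv) (hTv : Tv ≤ (1 - θ) * S * Nv) :
    Tu + X + Tv ≤ S * (1 - min (g - 6 * κ - 2 * b ^ 2 / θ) (θ / 2)) * (Nu + Nv) := by
  have hθ2 : 0 < θ / 2 := by positivity
  have hamgm := two_mul_le_div_add_mul (x := b * Real.sqrt Nu) (y := Real.sqrt Nv) hθ2
  have hsu : Real.sqrt Nu ^ 2 = Nu := Real.sq_sqrt hNu
  have hsv : Real.sqrt Nv ^ 2 = Nv := Real.sq_sqrt hNv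
  have hX' : X ≤ S * ((2 * b ^ 2 / θ) * Nu + (θ / 2) * Nv) := by
    have e1 : 2 * (b * S) * Real.sqrt Nu * Real.sqrt Nv = S * (2 * (b * Real.sqrt Nu) * Real.sqrt Nv) := by ring
    have e2 : (b * Real.sqrt Nu) ^ 2 / (θ / 2) + θ / 2 * Real.sqrt Nv ^ 2 = (2 * b ^ 2 / θ) * Nu + (θ / 2) * Nv := by
      rw [mul_pow, hsu, hsv]; field_simp
    rw [e1] at hX; rw [← e2]
    exact hX.trans (mul_le_mul_of_nonneg_left hamgm hS)
  set m := min (g - 6 * κ - 2 * b ^ 2 / θ) (θ / 2) with hm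
  have hm1 : m ≤ g - 6 * κ - 2 * b ^ 2 / θ := min_le_left _ _
  have hm2 : m ≤ θ / 2 := min_le_right _ _
  have hu : S * (1 - g + 6 * κ) * Nu + S * ((2 * b ^ 2 / θ) * Nu) ≤ S * (1 - m) * Nu := by
    have : (1 - g + 6 * κ) + 2 * b ^ 2 / θ ≤ 1 - m := by linarith
    have := mul_le_mul_of_nonneg_left this (mul_nonneg hS hNu)
    nlinarith
  have hv : (1 - θ) * S * Nv + S * ((θ / 2) * Nv) ≤ S * (1 - m) * Nv := by
    have : (1 - θ) + θ / 2 ≤ 1 - m := by linarith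
    have := mul_le_mul_of_nonneg_left this (mul_nonneg hS hNv)
    nlinarith
  nlinarith [hX', hu, hv, hTu, hTv]

/-- `(1+κ)(1−g) + κ ≤ (1 − g + 6κ)(1 − κ)` for `0 ≤ κ ≤ 1/2`, `0 ≤ g`. [folklore] -/
theorem arith_slow_shell {κ g : ℝ} (hκ0 : 0 ≤ κ) (hκ : κ ≤ 1 / 2) (hg0 : 0 ≤ g) :
    (1 + κ) * (1 - g) + κ ≤ (1 - g + 6 * κ) * (1 - κ) := by nlinarith

/-! ## §2 The SLOW clause of the shell: kernel brick + colour average + one-site annulus gain -/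

set_option maxHeartbeats 400000 in
/-- ★★ **SLOW CLAUSE OF THE SHELL (fixed `β`).**  Data as in ✓`slow_clause_of_bricks` (weight `w`, colour-blind profile `Ω`, `Ad`-invariant window `𝒰 ⊆ {orbitDist₁ < δ₁}`, `δ₁ ≤ 2`, (B-N) with
rate `κ ≤ 1/2`, (B-T, upper)); instead of the one-site min–max: the amplitude `boCoeff f` is supported in `{6t ≤ orbitDist₁}` and the ONE-SITE ANNULUS GAIN with gain `g ∈ [0,1]` holds for
gauge-invariant amplitudes supported in `{6t ≤ orbitDist₁} ∩ {orbitDist₁ < 2}`.  Then `T(Pf) ≤ σμ₀(1 − g + 6κ)·‖Pf‖²_w`. [cite: Luscher1983, §3] [cite: SimonB1983DiscreteSpectrum, §2] -/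
theorem shell_slow_clause {β : ℝ} {w : GaugeConfig 3 L SU2 → ℝ} (hw : Measurable w) {Cw : ℝ} (hCw : ∀ U, |w U| ≤ Cw) (hw0 : ∀ U, 0 ≤ w U)
    (hwinv : ∀ (c : SU2) (U : GaugeConfig 3 L SU2), w (gaugeTransform (fun _ : Site 3 L => c) U) = w U)
    {Ω : LinkSpace L → ℝ} (hΩ : Measurable Ω) {CΩ : ℝ} (hCΩ : ∀ x, |Ω x| ≤ CΩ) (hΩinv : ∀ (g : SU2) (v : LinkSpace L), Ω (adL L g v) = Ω v)
    {𝒰 : Set (GaugeConfig 3 1 SU2)} (h𝒰 : MeasurableSet 𝒰) (h𝒰inv : ∀ (c : SU2) (u : GaugeConfig 3 1 SU2), gaugeTransform (fun _ : Site 3 1 => c) u ∈ 𝒰 ↔ u ∈ 𝒰)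
    {δ₁ : ℝ} (h𝒰δ : ∀ u ∈ 𝒰, orbitDist u < δ₁) (hδ₁2 : δ₁ ≤ 2)
    {σ γ κ : ℝ} (hσ : 0 ≤ σ) (hγ : 0 < γ) (hκ0 : 0 ≤ κ) (hκ : κ ≤ 1 / 2)
    (hN : ∀ u ∈ 𝒰, |fibreMass L w Ω u - γ| ≤ κ * γ)
    (hT : ∀ φ : GaugeConfig 3 1 SU2 → ℝ, Measurable φ → (∃ C : ℝ, ∀ u, |φ u| ≤ C) → (∀ (g : Site 3 1 → SU2) (u : GaugeConfig 3 1 SU2), φ (gaugeTransform g u) = φ u) →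
      (∀ u, φ u ≠ 0 → u ∈ 𝒰) →
      tubeForm β (boFun L φ Ω) ≤ σ * γ * (1 + κ) * qform su2Rep ((L : ℝ) ^ 3 * β) φ φ + κ * σ * γ * levelValue su2Rep 1 ((L : ℝ) ^ 3 * β) 0 * l2 φ φ)
    {t g : ℝ} (hg0 : 0 ≤ g) (hg1 : g ≤ 1)
    (hAG : ∀ G : GaugeConfig 3 1 SU2 → ℝ, Measurable G → (∃ C : ℝ, ∀ u, |G u| ≤ C) →
      (∀ (g' : Site 3 1 → SU2) (u : GaugeConfig 3 1 SU2), G (gaugeTransform g' u) = G u) → (∀ u, G u ≠ 0 → 6 * t ≤ orbitDist u ∧ orbitDist u < 2) →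
      qform su2Rep ((L : ℝ) ^ 3 * β) G G ≤ (1 - g) * levelValue su2Rep 1 ((L : ℝ) ^ 3 * β) 0 * l2 G G)
    (hμ0 : 0 ≤ levelValue su2Rep 1 ((L : ℝ) ^ 3 * β) 0)
    {f : GaugeConfig 3 L SU2 → ℝ} (hfm : Measurable f) {Cf : ℝ} (hCf : ∀ U, |f U| ≤ Cf) (hφin : ∀ u, boCoeff L w Ω 𝒰 f u ≠ 0 → 6 * t ≤ orbitDist u) :
    tubeForm β (boProj L w Ω 𝒰 f) ≤ σ * levelValue su2Rep 1 ((L : ℝ) ^ 3 * β) 0 * (1 - g + 6 * κ) * tubeNormSq w (boProj L w Ω 𝒰 f) := by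
  set B : ℝ := (L : ℝ) ^ 3 * β with hB
  set μ0 : ℝ := levelValue su2Rep 1 B 0 with hμ0def
  have hκ1 : κ < 1 := by linarith
  have hκ1' : 0 < 1 - κ := by linarith
  have hZ : ∀ u ∈ 𝒰, γ * (1 - κ) ≤ fibreMass L w Ω u := fun u hu => by
    have := (abs_le.mp (hN u hu)).1; linarith
  have hZ₀ : 0 < γ * (1 - κ) := mul_pos hγ hκ1'
  -- the amplitude `φ = boCoeff f` and its colour average `G`
  set φ : GaugeConfig 3 1 SU2 → ℝ := boCoeff L w Ω 𝒰 f with hφdef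
  have hφm : Measurable φ := measurable_boCoeff hw hΩ h𝒰 hfm
  have hφb : ∀ u, |φ u| ≤ Cf * CΩ * Cw * (orthoTransverse L).real Set.univ / (γ * (1 - κ)) := abs_boCoeff_le hCw hCΩ hZ₀ hZ hCf
  have hφs : ∀ u, φ u ≠ 0 → u ∈ 𝒰 := fun u hu => by
    by_contra hnu; exact hu (show boCoeff L w Ω 𝒰 f u = 0 by unfold boCoeff; rw [Set.indicator_of_notMem hnu])
  set S : Set (GaugeConfig 3 1 SU2) := 𝒰 ∩ {u | 6 * t ≤ orbitDist u} with hSdef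
  have hSinv : ∀ (c : SU2) (u : GaugeConfig 3 1 SU2), gaugeTransform (fun _ : Site 3 1 => c) u ∈ S ↔ u ∈ S := fun c u => by
    simp only [hSdef, Set.mem_inter_iff, Set.mem_setOf_eq, orbitDist_gaugeTransform, h𝒰inv]
  have hφS : ∀ u, u ∉ S → φ u = 0 := fun u hu => by
    by_contra h
    exact hu ⟨hφs u h, hφin u h⟩
  set G : GaugeConfig 3 1 SU2 → ℝ := colourAvg (L := 1) φ with hGdef
  have hGm : Measurable G := measurable_colourAvg hφm
  have hGb : ∀ u, |G u| ≤ Cf * CΩ * Cw * (orthoTransverse L).real Set.univ / (γ * (1 - κ)) := abs_colourAvg_le hφm hφb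
  have hGg : ∀ (g' : Site 3 1 → SU2) (u : GaugeConfig 3 1 SU2), G (gaugeTransform g' u) = G u := fun g' u => colourAvg_one_site_gaugeInvariant φ g' u
  have hGS : ∀ u, G u ≠ 0 → u ∈ S := fun u hu => by
    by_contra hnu; exact hu (colourAvg_eq_zero_of_support (S := S) hSinv hφS hnu)
  have hGs𝒰 : ∀ u, G u ≠ 0 → u ∈ 𝒰 := fun u hu => (hGS u hu).1
  have hGann : ∀ u, G u ≠ 0 → 6 * t ≤ orbitDist u ∧ orbitDist u < 2 := fun u hu =>
    ⟨(hGS u hu).2, lt_of_lt_of_le (h𝒰δ u (hGS u hu).1) hδ₁2⟩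
  -- `P f = boFun φ Ω`, colour average on both sides
  have hPdef : boProj L w Ω 𝒰 f = boFun L φ Ω := rfl
  have hPm : Measurable (boFun L φ Ω) := measurable_boFun L hφm hΩ
  have hPb := abs_boFun_le L hφb hCΩ
  have hc : colourAvg (boFun L φ Ω) = boFun L G Ω := by funext U; rw [colourAvg_boFun L _ hΩinv U]
  -- form side
  have hform : tubeForm β (boProj L w Ω 𝒰 f) ≤ σ * γ * (1 + κ) * qform su2Rep B G G + κ * σ * γ * μ0 * l2 G G := by
    rw [hPdef, ← tubeForm_colourAvg β hPm hPb, hc]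
    exact hT G hGm ⟨_, hGb⟩ hGg hGs𝒰
  have hq : qform su2Rep B G G ≤ (1 - g) * μ0 * l2 G G := hAG G hGm ⟨_, hGb⟩ hGg hGann
  -- norm side: `γ(1−κ)‖G‖² ≤ ‖Pf‖²_w`
  have hnorm : γ * (1 - κ) * l2 G G ≤ tubeNormSq w (boProj L w Ω 𝒰 f) := by
    rw [hPdef]
    have h1 : tubeNormSq w (colourAvg (boFun L φ Ω)) ≤ tubeNormSq w (boFun L φ Ω) := tubeNormSq_colourAvg_le hw hCw hw0 hwinv hPm hPb
    rw [hc, tubeNormSq_boFun hGm hGb hΩ hCΩ hw hCw] at h1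
    refine le_trans ?_ h1
    rw [l2_self_eq_integral_sq, ← integral_const_mul]
    have hiL : Integrable (fun u => γ * (1 - κ) * G u ^ 2) (configMeasure SU2 1) :=
      (integrable_of_measurable_abs_le _ (hGm.pow_const 2) (C := (Cf * CΩ * Cw * (orthoTransverse L).real Set.univ / (γ * (1 - κ))) ^ 2) fun u => by
        rw [abs_pow]; exact pow_le_pow_left₀ (abs_nonneg _) (hGb u) 2).const_mul _
    have hM := measurable_fibreMass hw hΩ (L := L)
    have hMb : ∀ u, |fibreMass L w Ω u| ≤ CΩ ^ 2 * Cw * (orthoTransverse L).real Set.univ := fun u => by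
      haveI := isFiniteMeasure_orthoTransverse L
      unfold fibreMass
      have hCΩ0 : 0 ≤ CΩ := (abs_nonneg _).trans (hCΩ 0)
      calc |∫ v, Ω (linkEmbed L v) ^ 2 * w (orthoTube L u v) ∂orthoTransverse L| ≤ ∫ v, |Ω (linkEmbed L v) ^ 2 * w (orthoTube L u v)| ∂orthoTransverse L :=
            abs_integral_le_integral_abs
        _ ≤ ∫ _v, CΩ ^ 2 * Cw ∂orthoTransverse L := by
            refine integral_mono_of_nonneg (ae_of_all _ fun v => abs_nonneg _) (integrable_const _) (ae_of_all _ fun v => ?_)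
            show |Ω (linkEmbed L v) ^ 2 * w (orthoTube L u v)| ≤ CΩ ^ 2 * Cw
            rw [abs_mul, abs_pow]
            exact mul_le_mul (pow_le_pow_left₀ (abs_nonneg _) (hCΩ _) 2) (hCw _) (abs_nonneg _) (by positivity)
        _ = CΩ ^ 2 * Cw * (orthoTransverse L).real Set.univ := by rw [integral_const, smul_eq_mul, mul_comm]
    have hiR : Integrable (fun u => G u ^ 2 * fibreMass L w Ω u) (configMeasure SU2 1) :=
      integrable_of_measurable_abs_le _ ((hGm.pow_const 2).mul hM) (C := (Cf * CΩ * Cw * (orthoTransverse L).real Set.univ / (γ * (1 - κ))) ^ 2 * (CΩ ^ 2 * Cw * (orthoTransverse L).real Set.univ))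
        fun u => by rw [abs_mul, abs_pow]; exact mul_le_mul (pow_le_pow_left₀ (abs_nonneg _) (hGb u) 2) (hMb u) (abs_nonneg _) (by positivity)
    refine integral_mono hiL hiR fun u => ?_
    dsimp only
    by_cases hu : u ∈ 𝒰
    · have := hZ u hu; nlinarith [sq_nonneg (G u)]
    · have h0 : G u = 0 := by by_contra h; exact hu (hGs𝒰 u h)
      rw [h0]; simp
  -- arithmetic
  have hl2 : 0 ≤ l2 G G := l2_self_nonneg_lat _
  set n := l2 G G with hndef
  have hE := arith_slow_shell hκ0 hκ hg0
  have h1 : tubeForm β (boProj L w Ω 𝒰 f) ≤ σ * γ * ((1 + κ) * (1 - g) + κ) * μ0 * n := by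
    have := mul_le_mul_of_nonneg_left hq (by positivity : 0 ≤ σ * γ * (1 + κ))
    nlinarith [hform, this]
  have h2 : σ * γ * ((1 + κ) * (1 - g) + κ) * μ0 * n ≤ σ * γ * ((1 - g + 6 * κ) * (1 - κ)) * μ0 * n := by
    have := mul_le_mul_of_nonneg_left hE (by positivity : 0 ≤ σ * γ)
    have := mul_le_mul_of_nonneg_right (mul_le_mul_of_nonneg_right this hμ0) hl2
    linarith
  have h3 : σ * γ * ((1 - g + 6 * κ) * (1 - κ)) * μ0 * n = σ * μ0 * (1 - g + 6 * κ) * (γ * (1 - κ) * n) := by ring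
  have h15 : 0 ≤ 1 - g + 6 * κ := by linarith
  have h4 : σ * μ0 * (1 - g + 6 * κ) * (γ * (1 - κ) * n) ≤ σ * μ0 * (1 - g + 6 * κ) * tubeNormSq w (boProj L w Ω 𝒰 f) :=
    mul_le_mul_of_nonneg_left hnorm (by positivity)
  linarith [h1, h2, h3, h4]

/-! ## §3 The sup-version Feshbach split at fixed `β` -/

set_option maxHeartbeats 400000 in
/-- ★★ **THE SHELL GAIN AT FIXED `β` FROM THE FIXED-`β` BRICKS.**  With the data of `shell_slow_clause` for the weight `w = N/χ`, the stiff domination (B-ST) with gap `θ₀` for fibrewise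
`Ω`-orthogonal functions on `supp χ`, the off-diagonal brick (B-OD) with rate `b ≥ 0`, and the BO-support brick: every bounded measurable `f` supported in `supp χ` whose slow shadow lies in `𝒰`
and whose BO amplitude is supported in `{6t ≤ orbitDist₁}` satisfies `T(f) ≤ σμ₀·(1 − min(g − 6κ − 2b²/θ₀, θ₀/2))·‖f‖²_w`. [cite: Luscher1983, §3] [cite: SjostrandZworski2007, §2] -/
theorem shell_gain_fixed {β : ℝ} {χ : GaugeConfig 3 L SU2 → ℝ} (hwm : Measurable (softWeight χ)) {Cw : ℝ} (hCw : ∀ U, |softWeight χ U| ≤ Cw) (hw0 : ∀ U, 0 ≤ softWeight χ U)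
    (hwinv : ∀ (c : SU2) (U : GaugeConfig 3 L SU2), softWeight χ (gaugeTransform (fun _ : Site 3 L => c) U) = softWeight χ U)
    {Ω : LinkSpace L → ℝ} (hΩ : Measurable Ω) {CΩ : ℝ} (hCΩ : ∀ x, |Ω x| ≤ CΩ) (hΩinv : ∀ (g : SU2) (v : LinkSpace L), Ω (adL L g v) = Ω v)
    {𝒰 : Set (GaugeConfig 3 1 SU2)} (h𝒰 : MeasurableSet 𝒰) (h𝒰inv : ∀ (c : SU2) (u : GaugeConfig 3 1 SU2), gaugeTransform (fun _ : Site 3 1 => c) u ∈ 𝒰 ↔ u ∈ 𝒰)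
    {δ₁ : ℝ} (h𝒰δ : ∀ u ∈ 𝒰, orbitDist u < δ₁) (hδ₁2 : δ₁ ≤ 2)
    {σ γ κ : ℝ} (hσ : 0 ≤ σ) (hγ : 0 < γ) (hκ0 : 0 ≤ κ) (hκ : κ ≤ 1 / 2)
    (hN : ∀ u ∈ 𝒰, |fibreMass L (softWeight χ) Ω u - γ| ≤ κ * γ)
    (hT : ∀ φ : GaugeConfig 3 1 SU2 → ℝ, Measurable φ → (∃ C : ℝ, ∀ u, |φ u| ≤ C) → (∀ (g : Site 3 1 → SU2) (u : GaugeConfig 3 1 SU2), φ (gaugeTransform g u) = φ u) →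
      (∀ u, φ u ≠ 0 → u ∈ 𝒰) →
      tubeForm β (boFun L φ Ω) ≤ σ * γ * (1 + κ) * qform su2Rep ((L : ℝ) ^ 3 * β) φ φ + κ * σ * γ * levelValue su2Rep 1 ((L : ℝ) ^ 3 * β) 0 * l2 φ φ)
    {t g : ℝ} (hg0 : 0 ≤ g) (hg1 : g ≤ 1)
    (hAG : ∀ G : GaugeConfig 3 1 SU2 → ℝ, Measurable G → (∃ C : ℝ, ∀ u, |G u| ≤ C) →
      (∀ (g' : Site 3 1 → SU2) (u : GaugeConfig 3 1 SU2), G (gaugeTransform g' u) = G u) → (∀ u, G u ≠ 0 → 6 * t ≤ orbitDist u ∧ orbitDist u < 2) →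
      qform su2Rep ((L : ℝ) ^ 3 * β) G G ≤ (1 - g) * levelValue su2Rep 1 ((L : ℝ) ^ 3 * β) 0 * l2 G G)
    (hμ0 : 0 ≤ levelValue su2Rep 1 ((L : ℝ) ^ 3 * β) 0)
    {θ₀ b : ℝ} (hθ₀ : 0 < θ₀)
    (hST : ∀ v : GaugeConfig 3 L SU2 → ℝ, Measurable v → (∃ C : ℝ, ∀ U, |v U| ≤ C) → (∀ U, v U ≠ 0 → χ U ≠ 0) →
      (∀ u, fibreInner L (softWeight χ) Ω v u = 0) →
      tubeForm β v ≤ (1 - θ₀) * (σ * levelValue su2Rep 1 ((L : ℝ) ^ 3 * β) 0) * tubeNormSq (softWeight χ) v)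
    (hOD : ∀ (φ : GaugeConfig 3 1 SU2 → ℝ) (v : GaugeConfig 3 L SU2 → ℝ), Measurable φ → (∃ C : ℝ, ∀ u, |φ u| ≤ C) → (∀ u, φ u ≠ 0 → u ∈ 𝒰) →
      Measurable v → (∃ C : ℝ, ∀ U, |v U| ≤ C) → (∀ U, v U ≠ 0 → χ U ≠ 0) → (∀ u, fibreInner L (softWeight χ) Ω v u = 0) →
      |tubeCross β (boFun L φ Ω) v| ≤ b * (σ * levelValue su2Rep 1 ((L : ℝ) ^ 3 * β) 0) *
          Real.sqrt (tubeNormSq (softWeight χ) (boFun L φ Ω)) * Real.sqrt (tubeNormSq (softWeight χ) v) ∧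
      |tubeCross β v (boFun L φ Ω)| ≤ b * (σ * levelValue su2Rep 1 ((L : ℝ) ^ 3 * β) 0) *
          Real.sqrt (tubeNormSq (softWeight χ) (boFun L φ Ω)) * Real.sqrt (tubeNormSq (softWeight χ) v))
    (hbo : ∀ (φ : GaugeConfig 3 1 SU2 → ℝ) (U : GaugeConfig 3 L SU2), (∀ u, φ u ≠ 0 → u ∈ 𝒰) → boFun L φ Ω U ≠ 0 → χ U ≠ 0)
    {f : GaugeConfig 3 L SU2 → ℝ} (hfm : Measurable f) {Cf : ℝ} (hCf : ∀ U, |f U| ≤ Cf) (hfs : ∀ U, f U ≠ 0 → χ U ≠ 0) (hfsh : ∀ U, f U ≠ 0 → slowMean L U ∈ 𝒰)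
    (hφin : ∀ u, boCoeff L (softWeight χ) Ω 𝒰 f u ≠ 0 → 6 * t ≤ orbitDist u) :
    tubeForm β f ≤ σ * levelValue su2Rep 1 ((L : ℝ) ^ 3 * β) 0 * (1 - min (g - 6 * κ - 2 * b ^ 2 / θ₀) (θ₀ / 2)) * tubeNormSq (softWeight χ) f := by
  set w : GaugeConfig 3 L SU2 → ℝ := softWeight χ with hwdef
  set Sg : ℝ := σ * levelValue su2Rep 1 ((L : ℝ) ^ 3 * β) 0 with hSg
  have hSg0 : 0 ≤ Sg := mul_nonneg hσ hμ0
  have hκ1' : 0 < 1 - κ := by linarith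
  have hZ : ∀ u ∈ 𝒰, γ * (1 - κ) ≤ fibreMass L w Ω u := fun u hu => by
    have := (abs_le.mp (hN u hu)).1; linarith
  have hZ₀ : 0 < γ * (1 - κ) := mul_pos hγ hκ1'
  -- the split
  set u : GaugeConfig 3 L SU2 → ℝ := boProj L w Ω 𝒰 f with hudef
  set v : GaugeConfig 3 L SU2 → ℝ := fun U => f U - u U with hvdef
  have hPm : Measurable u := measurable_boFun L (measurable_boCoeff hwm hΩ h𝒰 hfm) hΩ
  have hPb : ∀ U, |u U| ≤ Cf * CΩ * Cw * (orthoTransverse L).real Set.univ / (γ * (1 - κ)) * CΩ :=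
    abs_boFun_le L (abs_boCoeff_le hCw hCΩ hZ₀ hZ hCf) hCΩ
  have hrem := remainder_props hwm hCw hΩ hCΩ h𝒰 hZ₀ hZ hbo hfm hCf hfs hfsh
  have hvm : Measurable v := hfm.sub hPm
  have hvb : ∀ U, |v U| ≤ Cf + Cf * CΩ * Cw * (orthoTransverse L).real Set.univ / (γ * (1 - κ)) * CΩ := fun U =>
    (abs_sub _ _).trans (add_le_add (hCf U) (hPb U))
  -- MASS (exact)
  have hmass : tubeNormSq w u + tubeNormSq w v = tubeNormSq w f := tubeNormSq_boProj_add hwm hCw hΩ hCΩ h𝒰 hZ₀ hZ hfm hCf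
  have hNu : 0 ≤ tubeNormSq w u := integral_nonneg fun U => mul_nonneg (sq_nonneg _) (hw0 U)
  have hNv : 0 ≤ tubeNormSq w v := integral_nonneg fun U => mul_nonneg (sq_nonneg _) (hw0 U)
  -- STIFF
  have hstiff : tubeForm β v ≤ (1 - θ₀) * Sg * tubeNormSq w v := hST v hvm ⟨_, hvb⟩ hrem.1 hrem.2
  -- OFFDIAG
  have hcs : ∀ u', boCoeff L w Ω 𝒰 f u' ≠ 0 → u' ∈ 𝒰 := fun u' hu => by
    by_contra hnu; exact hu (show boCoeff L w Ω 𝒰 f u' = 0 by unfold boCoeff; rw [Set.indicator_of_notMem hnu])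
  have hudef' : boFun L (boCoeff L w Ω 𝒰 f) Ω = u := rfl
  obtain ⟨h1, h2⟩ := hOD (boCoeff L w Ω 𝒰 f) v (measurable_boCoeff hwm hΩ h𝒰 hfm) ⟨_, abs_boCoeff_le hCw hCΩ hZ₀ hZ hCf⟩ hcs hvm ⟨_, hvb⟩ hrem.1 hrem.2
  rw [hudef'] at h1 h2
  have hX : tubeCross β u v + tubeCross β v u ≤ 2 * (b * Sg) * Real.sqrt (tubeNormSq w u) * Real.sqrt (tubeNormSq w v) := by
    have h1' := (abs_le.mp h1).2
    have h2' := (abs_le.mp h2).2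
    linarith
  -- SLOW
  have hslow : tubeForm β u ≤ Sg * (1 - g + 6 * κ) * tubeNormSq w u := by
    have h := shell_slow_clause hwm hCw hw0 hwinv hΩ hCΩ hΩinv h𝒰 h𝒰inv h𝒰δ hδ₁2 hσ hγ hκ0 hκ hN hT hg0 hg1 hAG hμ0 hfm hCf hφin
    have e : σ * levelValue su2Rep 1 ((L : ℝ) ^ 3 * β) 0 * (1 - g + 6 * κ) = Sg * (1 - g + 6 * κ) := by rw [hSg]
    rw [e] at h; exact h
  -- the form splits
  have hsplit : f = fun U => u U + v U := by funext U; simp only [hvdef]; ring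
  have hT4 : tubeForm β f = tubeForm β u + tubeCross β u v + tubeCross β v u + tubeForm β v := by
    conv_lhs => rw [hsplit]
    exact tubeForm_add β hPm hPb hvm hvb
  have hfin := arith_shell (Tu := tubeForm β u) (X := tubeCross β u v + tubeCross β v u) (Tv := tubeForm β v) hSg0 hNu hNv hθ₀ hslow hX hstiff
  rw [hT4, ← hmass]
  linarith [hfin]

end Summit.QuantumFields.YangMills.Theorems.FemtoTransferGap.TwoLattice.ConstTube

end
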